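import Mathlib
import Summits.Ventures.PercRepro2.V2SP
import Summits.Ventures.PercRepro2.Tail2DCount
import Summits.Ventures.PercRepro2.Tail2DThreePoint
import Summits.Ventures.PercRepro2.Tail2DFlowTwo
import Summits.Ventures.PercRepro2.Tail2DTransport
import Summits.Ventures.PercRepro2.Tail2DP2Series
import Summits.Ventures.PercRepro2.Tail2DDisjointPaths
import Summits.Ventures.PercRepro2.Tail2DThirdInequality
import Summits.Ventures.PercRepro2.Tail2DP2SeriesSP
import Summits.Ventures.PercRepro2.Tail2DCapOneSeries

/-!
# Every series–parallel pattern of capacity `≤ 2` is a transport factor (seat mine-b, cell pub-perc-repro2)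

The capacity `cap s` of a pattern is its uncoloured max-flow (`free ↦ 1`, `pin ↦ 2`, `absent ↦ 0`,
series `↦ min`, parallel `↦ +`); every configuration has `r + b ≤ cap s` (`flow_le_cap`: red and blue
paths are edge-disjoint). The patterns of capacity `≤ 2` are exactly the admissible factors of the
transport theorem `MTailPat.par_flow2'` (`FlowLeTwo`), and THIS FILE PROVES ITS NINE HYPOTHESES FOR
ALL OF THEM (`nine_of_cap`), hence (`MTailPat.par_cap2`): parallel composition with ANY pattern of
capacity `≤ 2` attaining the flows `(2,0)`, `(0,2)`, `(1,1)` keeps M♮ counting tails.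

PROOF, by induction over the factor `X`, of the stronger statement «the nine hold for `X ∧ Y` for every
`Y`» (`Nine (ser X Y)`): a factor of capacity `≤ 1` makes `X ∧ Y` trivial (`n₂₀ = n₀₂ = n₁₁ = 0`);
`pin ∧ Y` has `n₁₁ = c`, `n₁₀ = n₀₁ = X`, `n₀₀ = Z` and the only non-trivial hypothesis is
`Z·c ≤ X²` = Harris for `Y` (`harris_count`); `(A ∥ B) ∧ Y` with two capacity-one pieces is
`Tail2DCapOneSeries.lean`; a parallel factor with a capacity-`0` piece only scales every count
(`flowCount_ser_par_zero`), and the nine are homogeneous; a series factor `(X₁ ∧ X₂) ∧ Y` is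
`X₁ ∧ (X₂ ∧ Y)` or `X₂ ∧ (X₁ ∧ Y)` (`flowCount_ser_assoc`, `flowCount_ser_comm`). Finally the nine for
`X` itself are those of `X ∧ (pin ∥ pin)` (`flowCount_ser_pinpin`).
-/

namespace Summit.Ventures.PercRepro2.Tail2D

open V2Closure

/-! ### Capacity -/

/-- the capacity (uncoloured max-flow) of a pattern -/
def cap : V2Closure.SP → ℕ
  | .free => 1
  | .pin => 2
  | .absent => 0
  | .ser s t => min (cap s) (cap t)
  | .par s t => cap s + cap t

/-- every configuration has `r + b ≤ cap` -/
lemma flow_le_cap : ∀ (s : V2Closure.SP) (y : s.Conf), s.rLab y + s.bLab y ≤ cap s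
  | .free, y => by cases y <;> simp [SP.rLab, SP.bLab, cap]
  | .pin, _ => le_rfl
  | .absent, _ => le_rfl
  | .ser s t, ⟨a, b⟩ => by
    have h1 := flow_le_cap s a
    have h2 := flow_le_cap t b
    change min (s.rLab a) (t.rLab b) + min (s.bLab a) (t.bLab b) ≤ min (cap s) (cap t)
    omega
  | .par s t, ⟨a, b⟩ => by
    have h1 := flow_le_cap s a
    have h2 := flow_le_cap t b
    change s.rLab a + t.rLab b + (s.bLab a + t.bLab b) ≤ cap s + cap t
    omega

/-- capacity `≤ 2` is `FlowLeTwo` -/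
lemma flowLeTwo_of_cap {s : V2Closure.SP} (h : cap s ≤ 2) : FlowLeTwo s :=
  fun y => le_trans (flow_le_cap s y) h

/-- capacity `≤ 1` is `FlowLeOne` -/
lemma flowLeOne_of_cap {s : V2Closure.SP} (h : cap s ≤ 1) : FlowLeOne s :=
  fun y => le_trans (flow_le_cap s y) h

/-! ### The nine hypotheses (`Nine`, `Tail2DCapOneSeries.lean`) -/

/-- the nine hold when the counts `(2,0)`, `(0,2)`, `(1,1)` vanish -/
lemma Nine.of_le_one {Y : V2Closure.SP} (h : FlowLeOne Y) : Nine Y := by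
  have z : ∀ i j, 2 ≤ i + j → flowCount Y i j = 0 := by
    intro i j hij
    unfold flowCount
    rw [Finset.card_eq_zero]
    refine Finset.filter_eq_empty_iff.2 (fun y _ => ?_)
    have := h y; omega
  unfold Nine
  rw [z 2 0 (by norm_num), z 0 2 (by norm_num), z 1 1 (by norm_num)]
  simp

/-- the nine are invariant under scaling every count by a common factor -/
lemma Nine.of_scale {Y Z : V2Closure.SP} (m : ℕ) (h : ∀ i j, flowCount Y i j = m * flowCount Z i j) (hZ : Nine Z) :
    Nine Y := by
  unfold Nine at hZ ⊢
  simp only [h]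
  obtain ⟨h1, h2, h3, h4, h5, h6, h7, h8, h9⟩ := hZ
  refine ⟨?_, ?_, ?_, ?_, ?_, ?_, ?_, ?_, ?_⟩
  · nlinarith [Nat.mul_le_mul_left (m * m) h1]
  · nlinarith [Nat.mul_le_mul_left (m * m) h2]
  · nlinarith [Nat.mul_le_mul_left (m * m) h3]
  · nlinarith [Nat.mul_le_mul_left (m * m) h4]
  · nlinarith [Nat.mul_le_mul_left (m * m) h5]
  · nlinarith [Nat.mul_le_mul_left (m * m) h6]
  · nlinarith [Nat.mul_le_mul_left (m * m) h7]
  · nlinarith [Nat.mul_le_mul_left (m * m) h8]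
  · nlinarith [Nat.mul_le_mul_left (m * m) h9]

/-- the nine are determined by the six counts: transport along equalities of counts -/
lemma Nine.of_eq {Y Z : V2Closure.SP} (h : ∀ i j, flowCount Y i j = flowCount Z i j) (hZ : Nine Z) : Nine Y := by
  unfold Nine at hZ ⊢
  simp only [h]
  exact hZ

/-! ### Rearranging series compositions -/

section Rearrange

variable (X Y Z : V2Closure.SP)

/-- the counts of `X ∧ Y` and `Y ∧ X` agree -/
lemma flowCount_ser_comm (i j : ℕ) : flowCount (V2Closure.SP.ser X Y) i j = flowCount (V2Closure.SP.ser Y X) i j := by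
  unfold flowCount
  refine Finset.card_bij' (fun p _ => (p.2, p.1)) (fun p _ => (p.2, p.1)) ?_ ?_ ?_ ?_
  · intro p hp
    simp only [Finset.mem_filter, Finset.mem_univ, true_and] at hp ⊢
    change min (Y.rLab p.2) (X.rLab p.1) = i ∧ min (Y.bLab p.2) (X.bLab p.1) = j
    change min (X.rLab p.1) (Y.rLab p.2) = i ∧ min (X.bLab p.1) (Y.bLab p.2) = j at hp
    omega
  · intro p hp
    simp only [Finset.mem_filter, Finset.mem_univ, true_and] at hp ⊢
    change min (X.rLab p.2) (Y.rLab p.1) = i ∧ min (X.bLab p.2) (Y.bLab p.1) = j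
    change min (Y.rLab p.1) (X.rLab p.2) = i ∧ min (Y.bLab p.1) (X.bLab p.2) = j at hp
    omega
  · intro p _; rfl
  · intro p _; rfl

/-- the counts of `(X ∧ Y) ∧ Z` and `X ∧ (Y ∧ Z)` agree -/
lemma flowCount_ser_assoc (i j : ℕ) :
    flowCount (V2Closure.SP.ser (V2Closure.SP.ser X Y) Z) i j = flowCount (V2Closure.SP.ser X (V2Closure.SP.ser Y Z)) i j := by
  unfold flowCount
  refine Finset.card_bij' (fun p _ => (p.1.1, (p.1.2, p.2))) (fun p _ => ((p.1, p.2.1), p.2.2)) ?_ ?_ ?_ ?_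
  · intro p hp
    simp only [Finset.mem_filter, Finset.mem_univ, true_and] at hp ⊢
    change min (X.rLab p.1.1) (min (Y.rLab p.1.2) (Z.rLab p.2)) = i ∧ min (X.bLab p.1.1) (min (Y.bLab p.1.2) (Z.bLab p.2)) = j
    change min (min (X.rLab p.1.1) (Y.rLab p.1.2)) (Z.rLab p.2) = i ∧ min (min (X.bLab p.1.1) (Y.bLab p.1.2)) (Z.bLab p.2) = j at hp
    omega
  · intro p hp
    simp only [Finset.mem_filter, Finset.mem_univ, true_and] at hp ⊢
    change min (min (X.rLab p.1) (Y.rLab p.2.1)) (Z.rLab p.2.2) = i ∧ min (min (X.bLab p.1) (Y.bLab p.2.1)) (Z.bLab p.2.2) = j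
    change min (X.rLab p.1) (min (Y.rLab p.2.1) (Z.rLab p.2.2)) = i ∧ min (X.bLab p.1) (min (Y.bLab p.2.1) (Z.bLab p.2.2)) = j at hp
    omega
  · intro p _; rfl
  · intro p _; rfl

/-- the counts of `(X ∧ Y) ∧ Z` and `(Y ∧ X) ∧ Z` agree -/
lemma flowCount_ser_comm_left (i j : ℕ) :
    flowCount (V2Closure.SP.ser (V2Closure.SP.ser X Y) Z) i j = flowCount (V2Closure.SP.ser (V2Closure.SP.ser Y X) Z) i j := by
  unfold flowCount
  refine Finset.card_bij' (fun p _ => ((p.1.2, p.1.1), p.2)) (fun p _ => ((p.1.2, p.1.1), p.2)) ?_ ?_ ?_ ?_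
  · intro p hp
    simp only [Finset.mem_filter, Finset.mem_univ, true_and] at hp ⊢
    change min (min (X.rLab p.1.1) (Y.rLab p.1.2)) (Z.rLab p.2) = i ∧ min (min (X.bLab p.1.1) (Y.bLab p.1.2)) (Z.bLab p.2) = j at hp
    change min (min (Y.rLab p.1.2) (X.rLab p.1.1)) (Z.rLab p.2) = i ∧ min (min (Y.bLab p.1.2) (X.bLab p.1.1)) (Z.bLab p.2) = j
    omega
  · intro p hp
    simp only [Finset.mem_filter, Finset.mem_univ, true_and] at hp ⊢
    change min (min (Y.rLab p.1.1) (X.rLab p.1.2)) (Z.rLab p.2) = i ∧ min (min (Y.bLab p.1.1) (X.bLab p.1.2)) (Z.bLab p.2) = j at hp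
    change min (min (X.rLab p.1.2) (Y.rLab p.1.1)) (Z.rLab p.2) = i ∧ min (min (X.bLab p.1.2) (Y.bLab p.1.1)) (Z.bLab p.2) = j
    omega
  · intro p _; rfl
  · intro p _; rfl

/-- the counts of `X ∧ (pin ∥ pin)` are those of `X` when `cap X ≤ 2` -/
lemma flowCount_ser_pinpin (hX : cap X ≤ 2) (i j : ℕ) :
    flowCount (V2Closure.SP.ser X (V2Closure.SP.par .pin .pin)) i j = flowCount X i j := by
  unfold flowCount
  refine Finset.card_bij' (fun p _ => p.1) (fun x _ => (x, ((), ()))) ?_ ?_ ?_ ?_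
  · intro p hp
    simp only [Finset.mem_filter, Finset.mem_univ, true_and] at hp ⊢
    have := flow_le_cap X p.1
    change min (X.rLab p.1) (1 + 1) = i ∧ min (X.bLab p.1) (1 + 1) = j at hp
    omega
  · intro x hx
    simp only [Finset.mem_filter, Finset.mem_univ, true_and] at hx ⊢
    have := flow_le_cap X x
    change min (X.rLab x) (1 + 1) = i ∧ min (X.bLab x) (1 + 1) = j
    omega
  · intro p _; rfl
  · intro x _; rfl

/-- a parallel factor with a capacity-`0` piece on the left only scales the counts of `B ∧ Y` -/
lemma flowCount_ser_par_zero (A B : V2Closure.SP) (hA : cap A = 0) (i j : ℕ) :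
    flowCount (V2Closure.SP.ser (V2Closure.SP.par A B) Y) i j = Fintype.card A.Conf * flowCount (V2Closure.SP.ser B Y) i j := by
  unfold flowCount
  have hz : ∀ a : A.Conf, A.rLab a = 0 ∧ A.bLab a = 0 := fun a => by have := flow_le_cap A a; omega
  rw [← Finset.card_univ, ← Finset.card_product]
  refine Finset.card_bij' (fun p _ => (p.1.1, (p.1.2, p.2))) (fun p _ => ((p.1, p.2.1), p.2.2)) ?_ ?_ ?_ ?_
  · intro p hp
    simp only [Finset.mem_filter, Finset.mem_univ, true_and, Finset.mem_product] at hp ⊢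
    have := hz p.1.1
    change min (A.rLab p.1.1 + B.rLab p.1.2) (Y.rLab p.2) = i ∧ min (A.bLab p.1.1 + B.bLab p.1.2) (Y.bLab p.2) = j at hp
    change min (B.rLab p.1.2) (Y.rLab p.2) = i ∧ min (B.bLab p.1.2) (Y.bLab p.2) = j
    omega
  · intro p hp
    simp only [Finset.mem_filter, Finset.mem_univ, true_and, Finset.mem_product] at hp ⊢
    have := hz p.1
    change min (B.rLab p.2.1) (Y.rLab p.2.2) = i ∧ min (B.bLab p.2.1) (Y.bLab p.2.2) = j at hp
    change min (A.rLab p.1 + B.rLab p.2.1) (Y.rLab p.2.2) = i ∧ min (A.bLab p.1 + B.bLab p.2.1) (Y.bLab p.2.2) = j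
    omega
  · intro p _; rfl
  · intro p _; rfl

/-- the counts of `(A ∥ B) ∧ Y` and `(B ∥ A) ∧ Y` agree -/
lemma flowCount_ser_par_comm (A B : V2Closure.SP) (i j : ℕ) :
    flowCount (V2Closure.SP.ser (V2Closure.SP.par A B) Y) i j = flowCount (V2Closure.SP.ser (V2Closure.SP.par B A) Y) i j := by
  unfold flowCount
  refine Finset.card_bij' (fun p _ => ((p.1.2, p.1.1), p.2)) (fun p _ => ((p.1.2, p.1.1), p.2)) ?_ ?_ ?_ ?_
  · intro p hp
    simp only [Finset.mem_filter, Finset.mem_univ, true_and] at hp ⊢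
    change min (A.rLab p.1.1 + B.rLab p.1.2) (Y.rLab p.2) = i ∧ min (A.bLab p.1.1 + B.bLab p.1.2) (Y.bLab p.2) = j at hp
    change min (B.rLab p.1.2 + A.rLab p.1.1) (Y.rLab p.2) = i ∧ min (B.bLab p.1.2 + A.bLab p.1.1) (Y.bLab p.2) = j
    omega
  · intro p hp
    simp only [Finset.mem_filter, Finset.mem_univ, true_and] at hp ⊢
    change min (B.rLab p.1.1 + A.rLab p.1.2) (Y.rLab p.2) = i ∧ min (B.bLab p.1.1 + A.bLab p.1.2) (Y.bLab p.2) = j at hp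
    change min (A.rLab p.1.2 + B.rLab p.1.1) (Y.rLab p.2) = i ∧ min (A.bLab p.1.2 + B.bLab p.1.1) (Y.bLab p.2) = j
    omega
  · intro p _; rfl
  · intro p _; rfl

end Rearrange

/-! ### `pin ∧ Y` -/

section Pin

variable (Y : V2Closure.SP)

/-- the counts of `pin ∧ Y`: `(i, j) ↦ #{min r 1 = i ∧ min b 1 = j}` -/
lemma flowCount_ser_pin (i j : ℕ) :
    flowCount (V2Closure.SP.ser .pin Y) i j = (Finset.univ.filter (fun y : Y.Conf => min 1 (Y.rLab y) = i ∧ min 1 (Y.bLab y) = j)).card := by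
  unfold flowCount
  refine Finset.card_bij' (fun p _ => p.2) (fun y _ => ((), y)) ?_ ?_ ?_ ?_
  · intro p hp
    simp only [Finset.mem_filter, Finset.mem_univ, true_and] at hp ⊢
    change min 1 (Y.rLab p.2) = i ∧ min 1 (Y.bLab p.2) = j at hp
    exact hp
  · intro y hy
    simp only [Finset.mem_filter, Finset.mem_univ, true_and] at hy ⊢
    change min 1 (Y.rLab y) = i ∧ min 1 (Y.bLab y) = j
    exact hy
  · intro p _; rfl
  · intro y _; rfl

/-- the nine hold for `pin ∧ Y`: the only non-trivial one is Harris `Z·c ≤ X²` -/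
lemma Nine.ser_pin : Nine (V2Closure.SP.ser .pin Y) := by
  have e20 : flowCount (V2Closure.SP.ser .pin Y) 2 0 = 0 := by
    rw [flowCount_ser_pin, Finset.card_eq_zero]
    exact Finset.filter_eq_empty_iff.2 (fun y _ => by omega)
  have e02 : flowCount (V2Closure.SP.ser .pin Y) 0 2 = 0 := by
    rw [flowCount_ser_pin, Finset.card_eq_zero]
    exact Finset.filter_eq_empty_iff.2 (fun y _ => by omega)
  have e11 : flowCount (V2Closure.SP.ser .pin Y) 1 1 = (Finset.univ.filter (fun y : Y.Conf => 1 ≤ Y.rLab y ∧ 1 ≤ Y.bLab y)).card := by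
    rw [flowCount_ser_pin]; congr 1; ext y; simp only [Finset.mem_filter, Finset.mem_univ, true_and]
    exact ⟨fun h => by omega, fun h => by omega⟩
  have e10 : flowCount (V2Closure.SP.ser .pin Y) 1 0 = (Finset.univ.filter (fun y : Y.Conf => 1 ≤ Y.rLab y ∧ Y.bLab y = 0)).card := by
    rw [flowCount_ser_pin]; congr 1; ext y; simp only [Finset.mem_filter, Finset.mem_univ, true_and]
    exact ⟨fun h => by omega, fun h => by omega⟩
  have e01 : flowCount (V2Closure.SP.ser .pin Y) 0 1 = (Finset.univ.filter (fun y : Y.Conf => 1 ≤ Y.rLab y ∧ Y.bLab y = 0)).card := by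
    rw [flowCount_ser_pin]
    refine Eq.trans ?_ (card_swap Y (fun r b => 1 ≤ r ∧ b = 0))
    congr 1; ext y; simp only [Finset.mem_filter, Finset.mem_univ, true_and]
    exact ⟨fun h => by omega, fun h => by omega⟩
  have e00 : flowCount (V2Closure.SP.ser .pin Y) 0 0 = (Finset.univ.filter (fun y : Y.Conf => Y.rLab y = 0 ∧ Y.bLab y = 0)).card := by
    rw [flowCount_ser_pin]; congr 1; ext y; simp only [Finset.mem_filter, Finset.mem_univ, true_and]
    exact ⟨fun h => by omega, fun h => by omega⟩
  -- Harris for `Y` in the form `Z · c ≤ X²`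
  have hH := harris_count Y
  have r1 := card_r1_add Y
  have r3 := card_conn_add Y
  have r5 := card_rt_split Y 1
  rw [card_b0_eq_r0 Y] at r3
  set Z := (Finset.univ.filter (fun y : Y.Conf => Y.rLab y = 0 ∧ Y.bLab y = 0)).card
  set P := (Finset.univ.filter (fun y : Y.Conf => Y.rLab y = 0)).card
  set c := (Finset.univ.filter (fun y : Y.Conf => 1 ≤ Y.rLab y ∧ 1 ≤ Y.bLab y)).card
  set X := (Finset.univ.filter (fun y : Y.Conf => 1 ≤ Y.rLab y ∧ Y.bLab y = 0)).card
  set a₁ := (Finset.univ.filter (fun y : Y.Conf => 1 ≤ Y.rLab y)).card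
  set M := Fintype.card Y.Conf
  have hZc : Z * c ≤ X * X := by
    have h1 : (Z : ℤ) * M ≤ P ^ 2 := by exact_mod_cast hH
    have h2 : (a₁ : ℤ) + P = M := by exact_mod_cast r1
    have h3 : (c : ℤ) + P + P = M + Z := by exact_mod_cast r3
    have h4 : (a₁ : ℤ) = c + X := by exact_mod_cast r5
    have hM : (M : ℤ) = Z + 2 * X + c := by linarith
    have hP : (P : ℤ) = Z + X := by linarith
    have : (Z : ℤ) * c ≤ X * X := by rw [hM, hP] at h1; nlinarith [h1]
    exact_mod_cast this
  unfold Nine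
  rw [e20, e02, e11, e10, e01, e00]
  refine ⟨by simp, by simp, by simp, by simp, by simp, by simp, by simp, ?_, ?_⟩ <;> simpa using hZc

end Pin

/-! ### The master induction -/

/-- **the nine transport hypotheses hold for `X ∧ Y` whenever `cap X ≤ 2`**, for every `Y` -/
theorem Nine.ser_of_cap : ∀ (X : V2Closure.SP), cap X ≤ 2 → ∀ Y : V2Closure.SP, Nine (V2Closure.SP.ser X Y)
  | .free, _, Y => Nine.of_le_one (fun y => le_trans (flow_le_cap (V2Closure.SP.ser .free Y) y) (by simp [cap]))
  | .pin, _, Y => Nine.ser_pin Y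
  | .absent, _, Y => Nine.of_le_one (fun y => le_trans (flow_le_cap (V2Closure.SP.ser .absent Y) y) (by simp [cap]))
  | .ser X₁ X₂, h, Y => by
    have h' : min (cap X₁) (cap X₂) ≤ 2 := h
    by_cases h1 : cap X₁ ≤ 2
    · exact Nine.of_eq (fun i j => flowCount_ser_assoc X₁ X₂ Y i j) (Nine.ser_of_cap X₁ h1 (.ser X₂ Y))
    · have h2 : cap X₂ ≤ 2 := by omega
      refine Nine.of_eq (fun i j => ?_) (Nine.ser_of_cap X₂ h2 (.ser X₁ Y))
      rw [flowCount_ser_comm_left X₁ X₂ Y, flowCount_ser_assoc]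
  | .par A B, h, Y => by
    have h' : cap A + cap B ≤ 2 := h
    by_cases hA0 : cap A = 0
    · exact Nine.of_scale (Fintype.card A.Conf) (fun i j => flowCount_ser_par_zero Y A B hA0 i j)
        (Nine.ser_of_cap B (by omega) Y)
    by_cases hB0 : cap B = 0
    · refine Nine.of_scale (Fintype.card B.Conf) (fun i j => ?_) (Nine.ser_of_cap A (by omega) Y)
      rw [flowCount_ser_par_comm, flowCount_ser_par_zero Y B A hB0]
    -- both pieces have capacity one
    exact nine_serCapOne A B Y (flowLeOne_of_cap (s := A) (by omega)) (flowLeOne_of_cap (s := B) (by omega))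

/-- **the nine hold for every pattern of capacity `≤ 2`** -/
theorem Nine.of_cap {X : V2Closure.SP} (hX : cap X ≤ 2) : Nine X :=
  Nine.of_eq (fun i j => (flowCount_ser_pinpin X hX i j).symm) (Nine.ser_of_cap X hX (.par .pin .pin))

/-- **parallel composition with ANY pattern of capacity `≤ 2`** that attains the flows `(2,0)`, `(1,1)`
and `(0,2)` keeps the M♮ class -/
theorem MTailPat.par_cap2 {s : V2Closure.SP} {L : ℤ} (hs : MTailPat s L) (Y : V2Closure.SP) (hY : cap Y ≤ 2)
    (h20 : ∃ y : Y.Conf, Y.rLab y = 2 ∧ Y.bLab y = 0) (h11 : ∃ y : Y.Conf, Y.rLab y = 1 ∧ Y.bLab y = 1)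
    (h02 : ∃ y : Y.Conf, Y.rLab y = 0 ∧ Y.bLab y = 2) :
    MTailPat (.par s Y) (L + 2) ∧ MTailPat (.par Y s) (L + 2) := by
  have h := Nine.of_cap hY
  unfold Nine at h
  obtain ⟨hR2, hC2, hS, hE, hE', hR1, hC1, hΛa, hΛb⟩ := h
  exact MTailPat.par_flow2' hs Y (flowLeTwo_of_cap hY) h20 h11 h02 hR2 hC2 hS hE hE' hR1 hC1 hΛa hΛb

end Summit.Ventures.PercRepro2.Tail2D
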